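import Summits.CriticalPhenomena.PercolationContinuityZ3.Theorems.FK.InfiniteVolumeDLRClusters
import Summits.CriticalPhenomena.PercolationContinuityZ3.Theorems.FK.GibbsOneEdgeEnergy
import Summits.CriticalPhenomena.PercolationContinuityZ3.Theorems.PercNearOneGluingNoHeavyLowerTailCoSunflowerGlue
import Literature.Probability.LatticeModels.RandomClusterFKG
import HarnessLib

/-!
# FK-continuity transplant, FO-06/FO-10 (infinite-volume structure): the random-cluster specification
# kernel under the opening of one inside edge — Grimmett 2006, (3.3)/(4.12), the one-edge ratios of `φ^ξ_{Λ,p,q}`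

Registered R72 (cell INBOX l.5361, 2026-08-23); registry row FO-10b-g407; label DLR1e-A (coordinator fk-4 g140).
Cell `fk-continuity` (bschramm), FO-10b lineage (conditional one-edge energies); support file for the
FK-continuity transplant (`--supports stmt-CriticalPhenomena-4575`); builds on p205010 (kernel theorem,
internal audit signed; external expert review pending). Pure combinatorics about the definitions of
`InfiniteVolumeDLRDefs.lean`; no named facts, no sorries, standard axioms. General vertex type / general
dimension `d`. It is the combinatorial half of Grimmett's Prop. (4.37)(b) (`InfiniteVolumeDLROneEdgeIff.lean`):
the kernel `φ^ξ_{Λ,p,q}` has the one-edge conditional probabilities (3.3)/(4.38).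

* (the open graph of `ω ∪ {xy}` is `G(ω) ⊔ xy` — reused from the percolation files, `CoSunflowerGlue.openGraph_insert`);
* `meetClusterCount_insert_of_reachable`, `meetClusterCount_insert_add_one_of_not_reachable` — the number
  `k(ω, Λ)` of open clusters meeting `Λ` is unchanged by opening an edge between two already-joined
  vertices, and drops by exactly one when the edge joins two vertices of `Λ` lying in different clusters
  (for configurations on an ARBITRARY, possibly infinite, vertex type; `Λ` finite);
* `rcCondWeight_insert_mul` — **the one-edge weight ratio** of the specification kernel: for an inside edge
  `e = ⟨x,y⟩ ∈ E_Λ` and an inside pattern `η ∌ e`,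
  `w^ξ_Λ(η ∪ e) · (1-p) · q^{[x ↮ y in η ∪ (ξ ∖ E_Λ)]} = w^ξ_Λ(η) · p`;
* `rcCondProb_insert_mul_one_sub` — the same for the kernel, in the form
  `φ^ξ_Λ(η ∪ e) · (1 - π) = π · φ^ξ_Λ(η)` with `π = p` if `x ↔ y` in `η ∪ (ξ ∖ E_Λ)` and
  `π = p/(p + q(1-p))` otherwise (`0 ≤ p ≤ 1`, `q > 0`);
* `rcCondProb_pair_singleton`, `rcCondProb_pair_empty` — **the one-edge kernel** (Grimmett's (4.38)): for the
  region `{x, y}` spanned by a lattice edge `e`, `φ^ξ_{{x,y},p,q}(e open) = p` if `x ↔ y` in `ξ ∖ e` and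
  `= p/(p + q(1-p))` otherwise;
* bookkeeping for the outside σ-algebra `𝒯_Λ` and the cylinders `{ω ∩ E_Λ = η}` under the removal of one inside
  edge: `mem_iff_mem_of_measurableSet_cylinderEvents` (an event of `𝓕_S` is determined by the coordinates in `S`),
  `sdiff_singleton_mem_iff_of_outsideEvents`, `sdiff_singleton_eq_union_sdiff_of_mem_cylEvent`,
  `setOf_mem_inter_cylEvent_erase`, `coe_union_sdiff_mem_cylEvent_iff`, `coe_union_sdiff_mem_iff_of_outsideEvents`.

## References

* G. Grimmett, *The Random-Cluster Model*, Springer 2006: §1.2, Thm. (3.1) eq. (3.3), §4.2 (4.12),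
  Prop. (4.37) eq. (4.38), pp. 81–87. [Grimmett2006]
-/

noncomputable section

open MeasureTheory Set Filter
open scoped Topology ENNReal

namespace Summit.CriticalPhenomena.PercolationContinuityZ3.Theorems.FK

open Literature.Probability.Percolation Literature.Probability.LatticeModels

/-! ### Opening one edge: the open graph and the clusters meeting a finite set -/

section Insert

variable {V : Type*}

/-- **Opening an edge between two already-joined vertices does not change `k(·, S)`**, the number of
open clusters meeting `S`: the open clusters are the same. [cite: Grimmett2006, §1.2] -/
theorem meetClusterCount_insert_of_reachable (ω : BondConfig V) (S : Set V) {x y : V}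
    (h : (openGraph ω).Reachable x y) :
    meetClusterCount (insert s(x, y) ω) S = meetClusterCount ω S := by
  rw [meetClusterCount_eq, meetClusterCount_eq, CoSunflowerGlue.openGraph_insert]
  refine ncard_image_eq_of_forall_iff _ _ S fun u _ v _ => ?_
  rw [SimpleGraph.ConnectedComponent.eq, SimpleGraph.ConnectedComponent.eq]
  constructor
  · intro huv
    rcases reachable_sup_edge_imp (openGraph ω) x y huv with h' | ⟨h1, h2⟩ | ⟨h1, h2⟩
    · exact h'
    · exact h1.trans (h.trans h2)
    · exact h1.trans (h.symm.trans h2)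
  · intro huv
    exact huv.mono le_sup_left

/-- **Opening an edge between two vertices of `Λ` lying in different open clusters lowers `k(·, Λ)` by
exactly one** (`Λ` finite, the vertex type arbitrary): the clusters of `x` and of `y`, both meeting `Λ`,
merge, and no other cluster changes. [cite: Grimmett2006, §1.2] -/
theorem meetClusterCount_insert_add_one_of_not_reachable (ω : BondConfig V) {Λ : Set V} (hΛ : Λ.Finite)
    {x y : V} (hx : x ∈ Λ) (hy : y ∈ Λ) (h : ¬(openGraph ω).Reachable x y) :
    meetClusterCount (insert s(x, y) ω) Λ + 1 = meetClusterCount ω Λ := by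
  classical
  rw [meetClusterCount_eq, meetClusterCount_eq, CoSunflowerGlue.openGraph_insert]
  set G := openGraph ω with hG
  have hxy : x ≠ y := by
    rintro rfl
    exact h (SimpleGraph.Reachable.refl x)
  set π : G.ConnectedComponent → (G ⊔ SimpleGraph.edge x y).ConnectedComponent :=
    SimpleGraph.ConnectedComponent.map (SimpleGraph.Hom.ofLE le_sup_left) with hπ
  have hπmk : ∀ u, π (G.connectedComponentMk u) = (G ⊔ SimpleGraph.edge x y).connectedComponentMk u :=
    fun u => SimpleGraph.ConnectedComponent.map_mk _ _
  set T : Set G.ConnectedComponent := G.connectedComponentMk '' Λ with hT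
  have hTfin : T.Finite := hΛ.image _
  have hxT : G.connectedComponentMk x ∈ T := ⟨x, hx, rfl⟩
  have hyT : G.connectedComponentMk y ∈ T := ⟨y, hy, rfl⟩
  have hne : G.connectedComponentMk x ≠ G.connectedComponentMk y := fun h' =>
    h (SimpleGraph.ConnectedComponent.exact h')
  -- in `G ⊔ xy` the classes of `x` and `y` coincide
  have hxy' : (G ⊔ SimpleGraph.edge x y).connectedComponentMk x =
      (G ⊔ SimpleGraph.edge x y).connectedComponentMk y := by
    refine SimpleGraph.ConnectedComponent.sound (SimpleGraph.Adj.reachable ?_)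
    rw [SimpleGraph.sup_adj, SimpleGraph.edge_adj]
    exact Or.inr ⟨Or.inl ⟨rfl, rfl⟩, hxy⟩
  -- the image of `Λ` in the components of `G ⊔ xy` is the image under `π` of `T` minus the class of `y`
  have himg : (G ⊔ SimpleGraph.edge x y).connectedComponentMk '' Λ = π '' (T \ {G.connectedComponentMk y}) := by
    ext c
    constructor
    · rintro ⟨u, hu, rfl⟩
      by_cases huy : G.connectedComponentMk u = G.connectedComponentMk y
      · refine ⟨G.connectedComponentMk x, ⟨hxT, hne⟩, ?_⟩
        rw [hπmk, hxy', ← hπmk, ← huy, hπmk]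
      · exact ⟨G.connectedComponentMk u, ⟨⟨u, hu, rfl⟩, huy⟩, hπmk u⟩
    · rintro ⟨c', ⟨⟨u, hu, rfl⟩, -⟩, rfl⟩
      exact ⟨u, hu, (hπmk u).symm⟩
  -- `π` is injective away from the class of `y`
  have hinj : Set.InjOn π (T \ {G.connectedComponentMk y}) := by
    rintro c₁ ⟨⟨u₁, -, rfl⟩, h₁⟩ c₂ ⟨⟨u₂, -, rfl⟩, h₂⟩ hc
    rw [hπmk, hπmk] at hc
    rcases connectedComponentMk_sup_edge_eq_imp G x y hc with h' | ⟨-, h2⟩ | ⟨h1, -⟩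
    · exact h'
    · exact absurd h2 h₂
    · exact absurd h1 h₁
  rw [himg, hinj.ncard_image, Set.ncard_sdiff_singleton_add_one hyT hTfin]

end Insert

/-! ### The one-edge ratios of the specification kernel -/

section Kernel

variable {d : ℕ} {p q : ℝ}

/-- For `p ∈ [0,1]` and `q > 0` the denominator `p + q(1-p)` of Grimmett's (3.3)/(4.38) is positive. [cite: Grimmett2006, Thm. (3.1) eq. (3.3)] -/
theorem add_mul_one_sub_pos (hp : p ∈ Set.Icc (0 : ℝ) 1) (hq : 0 < q) : 0 < p + q * (1 - p) := by
  rcases hp.1.eq_or_lt with h0 | h0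
  · rw [← h0]; simpa using hq
  · nlinarith [hp.2, hq.le, mul_nonneg hq.le (sub_nonneg.2 hp.2)]

open scoped Classical in
/-- **The one-edge weight ratio of the specification kernel** (Grimmett 2006, the computation behind (3.3),
for the weights (4.12)): for an inside edge `e = ⟨x,y⟩ ∈ E_Λ` and an inside pattern `η ⊆ E_Λ` not containing
`e`, `w^ξ_Λ(η ∪ e) · (1-p) · q^{[x ↮ y]} = w^ξ_Λ(η) · p`, where `[x ↮ y] = 1` if `x`, `y` are NOT joined in
`η ∪ (ξ ∖ E_Λ)` and `0` otherwise. [cite: Grimmett2006, Thm. (3.1) eq. (3.3), §4.2 (4.12)] -/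
theorem rcCondWeight_insert_mul (Λ : Finset (Site d)) (ξ : BondConfig (Site d)) {x y : Site d}
    (he : s(x, y) ∈ edgesIn (zdGraph d) Λ) {η : Finset (Sym2 (Site d))} (heη : s(x, y) ∉ η) :
    rcCondWeight p q Λ ξ (insert s(x, y) η) * (1 - p) *
        q ^ (if (openGraph ((↑η : Set (Sym2 (Site d))) ∪ (ξ \ ↑(edgesIn (zdGraph d) Λ)))).Reachable x y
          then 0 else 1) =
      rcCondWeight p q Λ ξ η * p := by
  classical
  set U := edgesIn (zdGraph d) Λ with hU
  have hx : x ∈ Λ := (mem_edgesIn_iff.1 he).2 x (Sym2.mem_mk_left x y)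
  have hy : y ∈ Λ := (mem_edgesIn_iff.1 he).2 y (Sym2.mem_mk_right x y)
  set ω : BondConfig (Site d) := (↑η : Set (Sym2 (Site d))) ∪ (ξ \ ↑U) with hω
  have hins : ((↑(insert s(x, y) η) : Set (Sym2 (Site d))) ∪ (ξ \ ↑U)) = insert s(x, y) ω := by
    rw [Finset.coe_insert, Set.insert_union]
  rw [rcCondWeight_eq, rcCondWeight_eq, hins, Finset.card_insert_of_notMem heη]
  have hsd : U \ insert s(x, y) η = (U \ η).erase s(x, y) := by
    ext e
    simp only [Finset.mem_sdiff, Finset.mem_insert, not_or, Finset.mem_erase]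
    tauto
  have hmem : s(x, y) ∈ U \ η := Finset.mem_sdiff.2 ⟨he, heη⟩
  rw [hsd, Finset.card_erase_of_mem hmem]
  obtain ⟨m, hm⟩ : ∃ m, (U \ η).card = m + 1 :=
    ⟨_, (Nat.succ_pred_eq_of_pos (Finset.card_pos.2 ⟨_, hmem⟩)).symm⟩
  rw [hm, Nat.add_sub_cancel]
  split_ifs with hR
  · rw [meetClusterCount_insert_of_reachable ω _ hR, pow_zero, mul_one, pow_succ, pow_succ]
    ring
  · rw [← meetClusterCount_insert_add_one_of_not_reachable ω (Finset.finite_toSet Λ) (Finset.mem_coe.2 hx)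
      (Finset.mem_coe.2 hy) hR, pow_succ, pow_succ, pow_succ, pow_zero, one_mul]
    ring

open scoped Classical in
/-- **The one-edge ratio of the specification kernel** (Grimmett 2006, (3.3) for `φ^ξ_{Λ,p,q}`): for
`0 ≤ p ≤ 1`, `q > 0`, an inside edge `e = ⟨x,y⟩ ∈ E_Λ` and an inside pattern `η ⊆ E_Λ` not containing `e`,
`φ^ξ_Λ(η ∪ e) · (1 - π) = π · φ^ξ_Λ(η)` where `π = p` if `x ↔ y` in `η ∪ (ξ ∖ E_Λ)` and `π = p/(p + q(1-p))`
otherwise — the conditional probability that `e` is open given the rest is `π`. [cite: Grimmett2006, Thm. (3.1) eq. (3.3), Prop. (4.37) eq. (4.38)] -/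
theorem rcCondProb_insert_mul_one_sub (hp : p ∈ Set.Icc (0 : ℝ) 1) (hq : 0 < q) (Λ : Finset (Site d))
    (ξ : BondConfig (Site d)) {x y : Site d} (he : s(x, y) ∈ edgesIn (zdGraph d) Λ)
    {η : Finset (Sym2 (Site d))} (heη : s(x, y) ∉ η) :
    rcCondProb p q Λ ξ (insert s(x, y) η) *
        (1 - if (openGraph ((↑η : Set (Sym2 (Site d))) ∪ (ξ \ ↑(edgesIn (zdGraph d) Λ)))).Reachable x y
          then p else p / (p + q * (1 - p))) =
      (if (openGraph ((↑η : Set (Sym2 (Site d))) ∪ (ξ \ ↑(edgesIn (zdGraph d) Λ)))).Reachable x y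
          then p else p / (p + q * (1 - p))) * rcCondProb p q Λ ξ η := by
  have hK := rcCondWeight_insert_mul (p := p) (q := q) Λ ξ he heη
  have hZ := rcCondPartition_pos hp hq Λ ξ
  have hD := add_mul_one_sub_pos hp hq
  rw [rcCondProb_eq, rcCondProb_eq]
  split_ifs at hK ⊢ with hR
  · rw [pow_zero, mul_one] at hK
    field_simp
    linear_combination hK
  · rw [pow_one] at hK
    field_simp
    linear_combination hK

variable {x y : Site d}

open scoped Classical in
/-- **The one-edge kernel, Grimmett's (4.38)**: for the region `{x, y}` spanned by a lattice edge
`e = ⟨x,y⟩` (`E_{{x,y}} = {e}`), `0 ≤ p ≤ 1`, `q > 0`, the kernel gives the pattern "`e` open" probability `p`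
if `x ↔ y` in `ξ ∖ e` and `p/(p + q(1-p))` otherwise. [cite: Grimmett2006, Prop. (4.37) eq. (4.38)] -/
theorem rcCondProb_pair_singleton (hp : p ∈ Set.Icc (0 : ℝ) 1) (hq : 0 < q) (hxy : (zdGraph d).Adj x y)
    (ξ : BondConfig (Site d)) :
    rcCondProb p q {x, y} ξ {s(x, y)} =
      if (openGraph (ξ \ {s(x, y)})).Reachable x y then p else p / (p + q * (1 - p)) := by
  classical
  have hU : edgesIn (zdGraph d) {x, y} = {s(x, y)} := edgesIn_zdGraph_pair hxy
  have he : s(x, y) ∈ edgesIn (zdGraph d) {x, y} := by rw [hU]; exact Finset.mem_singleton_self _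
  have hpow : (edgesIn (zdGraph d) {x, y}).powerset = {∅, {s(x, y)}} := by
    rw [hU]
    ext t
    rw [Finset.mem_powerset, Finset.subset_singleton_iff, Finset.mem_insert, Finset.mem_singleton]
  have hne : (∅ : Finset (Sym2 (Site d))) ≠ {s(x, y)} := (Finset.singleton_ne_empty _).symm
  have h1 := sum_rcCondProb_eq_one hp hq {x, y} ξ
  rw [hpow, Finset.sum_pair hne] at h1
  have h2 := rcCondProb_insert_mul_one_sub hp hq {x, y} ξ he (Finset.notMem_empty (s(x, y)))
  simp only [Finset.insert_empty, Finset.coe_empty, Set.empty_union, hU, Finset.coe_singleton] at h2 ⊢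
  split_ifs at h2 ⊢ with hR
  · linear_combination h2 + p * h1
  · linear_combination h2 + p / (p + q * (1 - p)) * h1

open scoped Classical in
/-- The complementary entry of the one-edge kernel: the pattern "`e` closed" has probability `1 - p`,
resp. `1 - p/(p + q(1-p))`. [cite: Grimmett2006, Prop. (4.37) eq. (4.38)] -/
theorem rcCondProb_pair_empty (hp : p ∈ Set.Icc (0 : ℝ) 1) (hq : 0 < q) (hxy : (zdGraph d).Adj x y)
    (ξ : BondConfig (Site d)) :
    rcCondProb p q {x, y} ξ ∅ =
      1 - if (openGraph (ξ \ {s(x, y)})).Reachable x y then p else p / (p + q * (1 - p)) := by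
  classical
  have hU : edgesIn (zdGraph d) {x, y} = {s(x, y)} := edgesIn_zdGraph_pair hxy
  have hpow : (edgesIn (zdGraph d) {x, y}).powerset = {∅, {s(x, y)}} := by
    rw [hU]
    ext t
    rw [Finset.mem_powerset, Finset.subset_singleton_iff, Finset.mem_insert, Finset.mem_singleton]
  have hne : (∅ : Finset (Sym2 (Site d))) ≠ {s(x, y)} := (Finset.singleton_ne_empty _).symm
  have h1 := sum_rcCondProb_eq_one hp hq {x, y} ξ
  rw [hpow, Finset.sum_pair hne, rcCondProb_pair_singleton hp hq hxy ξ] at h1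
  linarith

end Kernel

/-! ### Events of a cylinder σ-algebra are determined by their coordinates -/

section Cylinder

variable {ι : Type*}

/-- **An event of the cylinder σ-algebra `𝓕_S` is determined by the coordinates in `S`**: two configurations
agreeing on `S` lie in it together (it is the preimage of a set under the restriction to `S`). [folklore] -/
theorem mem_iff_mem_of_measurableSet_cylinderEvents {S : Set ι} {H : Set (Set ι)}
    (hH : MeasurableSet[cylinderEvents (X := fun _ : ι => Prop) S] H) {ω ω' : Set ι}
    (h : ∀ i ∈ S, (i ∈ ω ↔ i ∈ ω')) : ω ∈ H ↔ ω' ∈ H := by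
  have hle : cylinderEvents (X := fun _ : ι => Prop) S ≤
      MeasurableSpace.comap (fun σ : ι → Prop => S.restrict σ) ⊤ := by
    refine iSup₂_le fun i hi => ?_
    have : (fun σ : ι → Prop => σ i) = (fun g : S → Prop => g ⟨i, hi⟩) ∘ fun σ : ι → Prop => S.restrict σ := rfl
    rw [this, ← MeasurableSpace.comap_comp]
    exact MeasurableSpace.comap_mono le_top
  obtain ⟨t, -, ht⟩ := hle _ hH
  have hr : S.restrict (fun i => i ∈ ω) = S.restrict (fun i => i ∈ ω') :=
    funext fun i => propext (h i i.2)
  have key : ∀ σ : Set ι, σ ∈ H ↔ S.restrict (fun i => i ∈ σ) ∈ t := fun σ => by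
    rw [← ht]
    exact Iff.rfl
  rw [key, key, hr]

end Cylinder

variable {d : ℕ}

/-! ### Outside events and cylinders under the removal of one inside edge -/

section OneEdgeSets

/-- **Outside events do not see an inside edge**: for `e ∈ E_Λ` and `H ∈ 𝒯_Λ`, `ω ∖ e ∈ H ↔ ω ∈ H`. [cite: Grimmett2006, §4.4 (𝒯_Λ)] -/
theorem sdiff_singleton_mem_iff_of_outsideEvents {Λ : Finset (Site d)} {H : Set (BondConfig (Site d))}
    (hH : MeasurableSet[outsideEvents d Λ] H) {e : Sym2 (Site d)} (he : e ∈ edgesIn (zdGraph d) Λ)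
    (ω : BondConfig (Site d)) : ω \ {e} ∈ H ↔ ω ∈ H :=
  mem_iff_mem_of_measurableSet_cylinderEvents hH fun i hi => by
    have hie : i ≠ e := by
      rintro rfl
      exact hi (Finset.mem_coe.2 he)
    rw [Set.mem_sdiff_singleton]
    exact ⟨fun h => h.1, fun h => ⟨h, hie⟩⟩

/-- On the cylinder `{ω ∩ (E_Λ ∖ e) = η}` (`e ∈ E_Λ`, `η ⊆ E_Λ ∖ e`), removing `e` leaves exactly the configuration
`η ∪ (ω ∖ E_Λ)` at which the kernel is read. [cite: Grimmett2006, §4.2 (4.12)] -/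
theorem sdiff_singleton_eq_union_sdiff_of_mem_cylEvent {U η : Finset (Sym2 (Site d))} {e : Sym2 (Site d)}
    (he : e ∈ U) (hη : η ⊆ U) (heη : e ∉ η) {ω : BondConfig (Site d)} (hω : ω ∈ cylEvent (U.erase e) η) :
    ω \ {e} = (↑η : Set (Sym2 (Site d))) ∪ (ω \ ↑U) := by
  ext i
  simp only [Set.mem_sdiff, Set.mem_singleton_iff, Set.mem_union, Finset.mem_coe]
  by_cases hie : i = e
  · subst hie
    exact ⟨fun h => absurd rfl h.2, fun h => h.elim (fun h => absurd h heη) fun h => absurd he h.2⟩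
  · by_cases hiU : i ∈ U
    · have h := mem_cylEvent_iff.1 hω i (Finset.mem_erase.2 ⟨hie, hiU⟩)
      constructor
      · rintro ⟨hiω, -⟩
        exact Or.inl (h.1 hiω)
      · rintro (hiη | ⟨hiω, -⟩)
        · exact ⟨h.2 hiη, hie⟩
        · exact ⟨hiω, hie⟩
    · constructor
      · rintro ⟨hiω, -⟩
        exact Or.inr ⟨hiω, hiU⟩
      · rintro (hiη | ⟨hiω, -⟩)
        · exact absurd (hη hiη) hiU
        · exact ⟨hiω, hie⟩

/-- Splitting off the state of `e`: `{e open} ∩ {ω ∩ (E_Λ ∖ e) = η} = {ω ∩ E_Λ = η ∪ e}`. [folklore] -/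
theorem setOf_mem_inter_cylEvent_erase {U η : Finset (Sym2 (Site d))} {e : Sym2 (Site d)} (he : e ∈ U) :
    {ω : BondConfig (Site d) | e ∈ ω} ∩ cylEvent (U.erase e) η = cylEvent U (insert e η) := by
  ext ω
  simp only [Set.mem_inter_iff, Set.mem_setOf_eq, mem_cylEvent_iff, Finset.mem_erase, Finset.mem_insert]
  constructor
  · rintro ⟨heω, h⟩ i hiU
    by_cases hie : i = e
    · subst hie
      exact ⟨fun _ => Or.inl rfl, fun _ => heω⟩
    · rw [h i ⟨hie, hiU⟩]
      exact ⟨fun hi => Or.inr hi, fun hi => hi.resolve_left hie⟩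
  · intro h
    refine ⟨(h e he).2 (Or.inl rfl), fun i hi => ?_⟩
    rw [h i hi.2]
    exact ⟨fun hi' => hi'.resolve_left hi.1, fun hi' => Or.inr hi'⟩

end OneEdgeSets

/-! ### The configuration charged by the kernel, against cylinders and outside events -/

section Charged

/-- The configuration `η' ∪ (ξ ∖ E_Λ)` charged by `φ^ξ_{Λ,p,q}` lies in the cylinder `{ω ∩ E_Λ = η}` iff
`η' = η` (`η, η' ⊆ E_Λ`). [cite: Grimmett2006, §4.2 (4.11)] -/
theorem coe_union_sdiff_mem_cylEvent_iff {Λ : Finset (Site d)} {η η' : Finset (Sym2 (Site d))}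
    (hη : η ⊆ edgesIn (zdGraph d) Λ) (hη' : η' ⊆ edgesIn (zdGraph d) Λ) (ξ : BondConfig (Site d)) :
    (↑η' : Set (Sym2 (Site d))) ∪ (ξ \ ↑(edgesIn (zdGraph d) Λ)) ∈ cylEvent (edgesIn (zdGraph d) Λ) η ↔
      η' = η := by
  rw [mem_cylEvent_iff]
  constructor
  · intro h
    ext i
    by_cases hi : i ∈ edgesIn (zdGraph d) Λ
    · have := h i hi
      simp only [Set.mem_union, Finset.mem_coe, Set.mem_sdiff, hi, not_true_eq_false, and_false, or_false] at this
      exact this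
    · exact ⟨fun h' => absurd (hη' h') hi, fun h' => absurd (hη h') hi⟩
  · rintro rfl i hi
    simp only [Set.mem_union, Finset.mem_coe, Set.mem_sdiff, hi, not_true_eq_false, and_false, or_false]

/-- The configuration `η' ∪ (ξ ∖ E_Λ)` lies in an outside event `H ∈ 𝒯_Λ` iff `ξ` does (`η' ⊆ E_Λ`). [cite: Grimmett2006, §4.4 (𝒯_Λ)] -/
theorem coe_union_sdiff_mem_iff_of_outsideEvents {Λ : Finset (Site d)} {η' : Finset (Sym2 (Site d))}
    (hη' : η' ⊆ edgesIn (zdGraph d) Λ) {H : Set (BondConfig (Site d))} (hH : MeasurableSet[outsideEvents d Λ] H)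
    (ξ : BondConfig (Site d)) :
    (↑η' : Set (Sym2 (Site d))) ∪ (ξ \ ↑(edgesIn (zdGraph d) Λ)) ∈ H ↔ ξ ∈ H :=
  mem_iff_mem_of_measurableSet_cylinderEvents hH fun i hi => by
    have hiU : i ∉ edgesIn (zdGraph d) Λ := fun h => hi (Finset.mem_coe.2 h)
    simp only [Set.mem_union, Finset.mem_coe, Set.mem_sdiff, hiU, not_false_eq_true, and_true, or_iff_right_iff_imp]
    exact fun h => absurd (hη' h) hiU

end Charged

end Summit.CriticalPhenomena.PercolationContinuityZ3.Theorems.FK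

end
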